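import Summits.Langlands.Langlands.Theorems.PhantomRMYoshidaResiduallyYoshidaLiftingDefs
import HarnessLib

/-!
# The twist corner is a QUADRATIC twist (stub `stub_twistCornerQuadratic`) — line `sector-klingen-split`, crux `ResiduallyYoshidaLifting`

Stub-worker of lead prover-line-stmt-Langlands-13639-c3-0 (wave 2, 2026-08-17), skeleton rev 5 (corner stub `stub_cornerTwist`).  If
`σ̄'` is a pointwise-scalar twist of a conjugate of `σ̄` (`g σ̄(x) g⁻¹ = c(x) σ̄'(x)`), then `c` is a CHARACTER with `c² = 1` (compare
determinants: `det σ̄ = c² det σ̄'` and `det σ̄' = det σ̄` by `DetC`), non-trivial (else `σ̄, σ̄'` would be conjugate): `σ̄' ≅ σ̄ ⊗ χ`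
for a quadratic character `χ` — the twist corner is the locus of quadratic-twist pairs (fibres carrying the INDUCED stable components).
-/

noncomputable section

set_option linter.dupNamespace false
set_option autoImplicit false

open Literature.NumberTheory.GaloisRepresentations
open Summit.Langlands.Langlands.Cruxes.ResiduallyYoshidaLifting.YoshidaDivisorSelmerCount

namespace Summit.Langlands.Langlands.Cruxes.ResiduallyYoshidaLifting.SectorKlingenSplit

/-- Scalars are detected on an invertible matrix: `a • u = b • u` with `u ∈ GL₂(k)` forces `a = b`
(multiply by `u⁻¹` on the right and read off the `(0,0)` entry). [folklore] -/
private theorem smul_gl_val_cancel {k : Type} [Field k] (u : GL (Fin 2) k) {a b : k}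
    (h : a • (u : Matrix (Fin 2) (Fin 2) k) = b • (u : Matrix (Fin 2) (Fin 2) k)) : a = b := by
  have h2 := congrArg (· * ((u⁻¹ : GL (Fin 2) k) : Matrix (Fin 2) (Fin 2) k)) h
  simp only [Matrix.smul_mul, Units.mul_inv] at h2
  simpa using congrFun (congrFun h2 0) 0

/-- **Registered statement `stub_twistCornerQuadratic`**: on the twist corner the twisting scalar is a non-trivial quadratic
character. [folklore] -/
theorem stub_twistCornerQuadratic :
    ∀ (p : ℕ) [Fact p.Prime], p ≠ 2 → ∀ (k : Type) [Field k] [CharP k p] [TopologicalSpace k] [DiscreteTopology k]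
    (σ σ' : FramedGaloisRep ℚ k 2),
    DetC p k σ σ' → (¬ ∃ g : GL (Fin 2) k, ∀ x, g * σ x * g⁻¹ = σ' x) →
    (∃ g : GL (Fin 2) k, ∀ x, ∃ c : k, (g * σ x * g⁻¹).val = c • (σ' x).val) →
    ∃ (g : GL (Fin 2) k) (χ : Field.absoluteGaloisGroup ℚ →* kˣ),
      (∀ x, (χ x : k) = 1 ∨ (χ x : k) = -1) ∧ (∃ x, (χ x : k) ≠ 1) ∧
      ∀ x, (g * σ x * g⁻¹).val = (χ x : k) • (σ' x).val := by
  intro _ _ _ k _ _ _ _ σ σ' hdet hnc htw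
  obtain ⟨g, htw⟩ := htw
  choose c hc using htw
  -- (i) the scalar is non-zero: a unit of `M₂(k)` is not `0 • _ = 0`
  have hc0 : ∀ x, c x ≠ 0 := fun x hx =>
    (g * σ x * g⁻¹).ne_zero (by rw [hc x, hx, zero_smul])
  -- (ii) multiplicative: uniqueness of the scalar on the invertible `σ' (x * y)`
  have hmul : ∀ x y, c (x * y) = c x * c y := by
    intro x y
    refine smul_gl_val_cancel (σ' (x * y)) ?_
    rw [← hc (x * y), show g * σ (x * y) * g⁻¹ = (g * σ x * g⁻¹) * (g * σ y * g⁻¹) by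
      simp only [map_mul, mul_assoc, inv_mul_cancel_left], Units.val_mul, hc x, hc y, map_mul,
      Units.val_mul, Matrix.smul_mul, Matrix.mul_smul, smul_smul]
  -- (iii) quadratic: `det (g σ g⁻¹) = det σ = c² · det σ'` and `det σ' = det σ` (`DetC`)
  have hsq : ∀ x, c x = 1 ∨ c x = -1 := by
    intro x
    have hne : ((σ x : GL (Fin 2) k) : Matrix (Fin 2) (Fin 2) k).det ≠ 0 := by
      rw [← Matrix.GeneralLinearGroup.val_det_apply]
      exact (Matrix.GeneralLinearGroup.det (σ x)).ne_zero
    have h2 : ((σ' x : GL (Fin 2) k) : Matrix (Fin 2) (Fin 2) k).det =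
        ((σ x : GL (Fin 2) k) : Matrix (Fin 2) (Fin 2) k).det := by
      rw [← Matrix.GeneralLinearGroup.val_det_apply, ← Matrix.GeneralLinearGroup.val_det_apply,
        ← FramedRep.det_apply, ← FramedRep.det_apply, (hdet x).2]
    have h1 : ((g * σ x * g⁻¹ : GL (Fin 2) k) : Matrix (Fin 2) (Fin 2) k).det =
        ((σ x : GL (Fin 2) k) : Matrix (Fin 2) (Fin 2) k).det := by
      rw [← Matrix.GeneralLinearGroup.val_det_apply, ← Matrix.GeneralLinearGroup.val_det_apply,
        map_mul, map_mul, map_inv, mul_inv_cancel_comm]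
    rw [hc x, Matrix.det_smul, Fintype.card_fin, h2, mul_eq_right₀ hne] at h1
    exact mul_self_eq_one_iff.mp (by rw [← pow_two, h1])
  -- the twisting character `χ = c`, valued in `kˣ`
  obtain ⟨χ, hχ⟩ : ∃ χ : Field.absoluteGaloisGroup ℚ →* kˣ, ∀ x, (χ x : k) = c x :=
    ⟨MonoidHom.mk' (fun x => Units.mk0 (c x) (hc0 x)) fun x y =>
      Units.ext (by simp only [Units.val_mul, Units.val_mk0, hmul]), fun _ => rfl⟩
  refine ⟨g, χ, fun x => by rw [hχ]; exact hsq x, ?_, fun x => by rw [hχ]; exact hc x⟩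
  -- (iv) non-trivial: otherwise `g σ g⁻¹ = σ'`, contradicting non-conjugacy
  by_contra htriv
  push Not at htriv
  exact hnc ⟨g, fun x => Units.ext (by rw [hc x, ← hχ x, htriv x, one_smul])⟩

end Summit.Langlands.Langlands.Cruxes.ResiduallyYoshidaLifting.SectorKlingenSplit

end
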